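import Mathlib

/-!
# Route LiouvilleSarnak — crux `DigitalBilinearLiouville` (stmt-ValiantsHypothesis-14774), line
# `tt_star`: the registered stub `stub_fourthMoment`

The registered skeleton `Cruxes/DigitalBilinearLiouville/Lines/tt_star.lean`
(line-writer `linewriter-valiant-liouvmonotone-1-g0`, 2026-08-31) cuts the crux
`DigitalBilinearLiouville` (operator norm `o(2^n)` of every balanced digital cut matrix of the
Liouville function) by the `T T^*` method into a linear-algebra stub and an arithmetic stub.  This
file proves the linear-algebra stub `stub_fourthMoment` with EXACTLY the registered signature (the
skeleton closes its `sorry` by the term `stub_fourthMoment` of this namespace):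

for any finite complex matrix `M : ι → κ → ℂ` and test vectors `u : ι → ℂ`, `w : κ → ℂ`,
`‖Σ_r Σ_c u_r w_c M_{rc}‖⁴ ≤ (Σ_{r,r'} ‖Σ_c M_{rc} conj(M_{r'c})‖²) (Σ_r ‖u_r‖²)² (Σ_c ‖w_c‖²)²`.

Proof (two Cauchy–Schwarz steps, no spectral theorem): with `v_c = Σ_r u_r M_{rc}` one has
`S = Σ_c w_c v_c`, so `‖S‖² ≤ ‖w‖² Σ_c ‖v_c‖²` (§1); and
`Σ_c ‖v_c‖² = Σ_{r,r'} u_r conj(u_{r'}) G_{rr'}` with `G = M M^*` (§2, expansion), whence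
`(Σ_c ‖v_c‖²)² ≤ (Σ_{r,r'} ‖u_r‖² ‖u_{r'}‖²) ‖G‖_F² = ‖u‖⁴ ‖G‖_F²` (Cauchy–Schwarz on `ι × ι`).

Honest framing: the folklore half of a registered line; the arithmetic stub
`stub_twoPointDigital` (pair correlations of `λ` along digital families, crux-equivalent up to
`ε ↔ ε²`), the crux `DigitalBilinearLiouville`, `LiouvilleCutRank` and `AlgebraicSarnak` stay open,
and nothing here bears on VP versus VNP.  No definitions.
-/

-- the directory `ValiantsHypothesis/ValiantsHypothesis` repeats the summit name (tree layout)
set_option linter.dupNamespace false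

namespace Summit.ValiantsHypothesis.ValiantsHypothesis.Theorems.LiouvilleSarnakDigitalBilinearLiouville.TtStar

open Finset

/-! ### §1 Cauchy–Schwarz for complex finite sums -/

/-- **Cauchy–Schwarz** over a finset, complex entries:
`‖Σ_{i ∈ s} a_i b_i‖² ≤ (Σ_{i ∈ s} ‖a_i‖²) (Σ_{i ∈ s} ‖b_i‖²)`. [folklore] -/
theorem norm_sum_mul_sq_le_of_finset {α : Type*} (s : Finset α) (a b : α → ℂ) :
    ‖∑ i ∈ s, a i * b i‖ ^ 2 ≤ (∑ i ∈ s, ‖a i‖ ^ 2) * (∑ i ∈ s, ‖b i‖ ^ 2) := by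
  have h1 : ‖∑ i ∈ s, a i * b i‖ ≤ ∑ i ∈ s, ‖a i‖ * ‖b i‖ :=
    (norm_sum_le _ _).trans (Finset.sum_le_sum fun i _ => norm_mul_le _ _)
  have h2 := Finset.sum_mul_sq_le_sq_mul_sq s (fun i => ‖a i‖) (fun i => ‖b i‖)
  calc ‖∑ i ∈ s, a i * b i‖ ^ 2 ≤ (∑ i ∈ s, ‖a i‖ * ‖b i‖) ^ 2 := by gcongr
    _ ≤ (∑ i ∈ s, ‖a i‖ ^ 2) * (∑ i ∈ s, ‖b i‖ ^ 2) := h2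

/-- A nonnegative real sum, read in `ℂ`, written as `Σ z conj(z)`:
`((Σ_c ‖v_c‖² : ℝ) : ℂ) = Σ_c v_c conj(v_c)`. [folklore] -/
theorem ofReal_sum_norm_sq {κ : Type*} (s : Finset κ) (v : κ → ℂ) :
    ((∑ c ∈ s, ‖v c‖ ^ 2 : ℝ) : ℂ) = ∑ c ∈ s, v c * star (v c) := by
  push_cast
  refine Finset.sum_congr rfl fun c _ => ?_
  rw [Complex.star_def, Complex.mul_conj, Complex.normSq_eq_norm_sq]
  push_cast
  ring

/-! ### §2 The `T T^*` expansion -/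

/-- **`T T^*` expansion.**  With `v_c = Σ_r u_r M_{rc}`:
`Σ_c v_c conj(v_c) = Σ_r Σ_{r'} u_r conj(u_{r'}) (Σ_c M_{rc} conj(M_{r'c}))`. [folklore] -/
theorem sum_rowComb_mul_star {ι κ : Type*} [Fintype ι] [Fintype κ]
    (M : ι → κ → ℂ) (u : ι → ℂ) :
    ∑ c, (∑ r, u r * M r c) * star (∑ r, u r * M r c) =
      ∑ r, ∑ r', u r * star (u r') * ∑ c, M r c * star (M r' c) := by
  calc ∑ c, (∑ r, u r * M r c) * star (∑ r, u r * M r c)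
      = ∑ c, ∑ r, ∑ r', u r * M r c * (star (u r') * star (M r' c)) := by
        refine Finset.sum_congr rfl fun c _ => ?_
        rw [star_sum, Finset.sum_mul]
        refine Finset.sum_congr rfl fun r _ => ?_
        rw [Finset.mul_sum]
        refine Finset.sum_congr rfl fun r' _ => ?_
        rw [star_mul', ]
    _ = ∑ r, ∑ r', ∑ c, u r * M r c * (star (u r') * star (M r' c)) := by
        rw [Finset.sum_comm]
        exact Finset.sum_congr rfl fun r _ => Finset.sum_comm
    _ = ∑ r, ∑ r', u r * star (u r') * ∑ c, M r c * star (M r' c) := by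
        refine Finset.sum_congr rfl fun r _ => Finset.sum_congr rfl fun r' _ => ?_
        rw [Finset.mul_sum]
        exact Finset.sum_congr rfl fun c _ => by ring

/-- **Second Cauchy–Schwarz step.**  With `v_c = Σ_r u_r M_{rc}` and `G = M M^*`:
`(Σ_c ‖v_c‖²)² ≤ (Σ_{r,r'} ‖G_{rr'}‖²) (Σ_r ‖u_r‖²)²`. [folklore] -/
theorem sum_norm_rowComb_sq_sq_le {ι κ : Type*} [Fintype ι] [Fintype κ]
    (M : ι → κ → ℂ) (u : ι → ℂ) :
    (∑ c, ‖∑ r, u r * M r c‖ ^ 2) ^ 2 ≤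
      (∑ r, ∑ r', ‖∑ c, M r c * star (M r' c)‖ ^ 2) * (∑ r, ‖u r‖ ^ 2) ^ 2 := by
  -- the real sum as the norm of a complex double sum
  have hre : (∑ c, ‖∑ r, u r * M r c‖ ^ 2 : ℝ) =
      ‖∑ r, ∑ r', u r * star (u r') * ∑ c, M r c * star (M r' c)‖ := by
    rw [← sum_rowComb_mul_star M u, ← ofReal_sum_norm_sq, Complex.norm_real,
      Real.norm_of_nonneg (Finset.sum_nonneg fun c _ => by positivity)]
  -- `Σ_{(r,r')} ‖u_r conj u_{r'}‖² = (Σ_r ‖u_r‖²)²`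
  have hu : (∑ p : ι × ι, ‖u p.1 * star (u p.2)‖ ^ 2) = (∑ r, ‖u r‖ ^ 2) ^ 2 := by
    rw [sq (∑ r, ‖u r‖ ^ 2), Finset.sum_mul_sum, ← Fintype.sum_prod_type']
    exact Finset.sum_congr rfl fun p _ => by rw [norm_mul, norm_star, mul_pow]
  -- pass to sums over `ι × ι` and apply Cauchy–Schwarz there
  rw [hre, ← Fintype.sum_prod_type', ← Fintype.sum_prod_type']
  refine (norm_sum_mul_sq_le_of_finset _ _ _).trans (le_of_eq ?_)
  rw [hu, mul_comm]

/-! ### §3 The registered stub -/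

/-- **Stub `stub_fourthMoment` of line `tt_star` (crux `DigitalBilinearLiouville`,
stmt-ValiantsHypothesis-14774), PROVED — exactly the registered signature.**  For any finite
complex matrix `M` and test vectors `u, w`:
`‖Σ_r Σ_c u_r w_c M_{rc}‖⁴ ≤ (Σ_{r,r'} ‖Σ_c M_{rc} conj(M_{r'c})‖²) (Σ_r ‖u_r‖²)² (Σ_c ‖w_c‖²)²`
(two Cauchy–Schwarz steps, §1–§2). [folklore] -/
theorem stub_fourthMoment :
    ∀ {ι κ : Type} [Fintype ι] [Fintype κ] (M : ι → κ → ℂ) (u : ι → ℂ) (w : κ → ℂ),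
      ‖∑ r, ∑ c, u r * w c * M r c‖ ^ 4 ≤
        (∑ r, ∑ r', ‖∑ c, M r c * star (M r' c)‖ ^ 2) *
          (∑ r, ‖u r‖ ^ 2) ^ 2 * (∑ c, ‖w c‖ ^ 2) ^ 2 := by
  intro ι κ _ _ M u w
  -- `S = Σ_c w_c v_c` with `v_c = Σ_r u_r M_{rc}`
  have hS : ∑ r, ∑ c, u r * w c * M r c = ∑ c, w c * ∑ r, u r * M r c := by
    rw [Finset.sum_comm]
    refine Finset.sum_congr rfl fun c _ => ?_
    rw [Finset.mul_sum]
    exact Finset.sum_congr rfl fun r _ => by ring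
  -- first Cauchy–Schwarz step
  have h1 : ‖∑ r, ∑ c, u r * w c * M r c‖ ^ 2 ≤
      (∑ c, ‖w c‖ ^ 2) * (∑ c, ‖∑ r, u r * M r c‖ ^ 2) := by
    rw [hS]
    exact norm_sum_mul_sq_le_of_finset _ _ _
  -- second Cauchy–Schwarz step
  have h2 := sum_norm_rowComb_sq_sq_le M u
  have hw0 : 0 ≤ ∑ c, ‖w c‖ ^ 2 := Finset.sum_nonneg fun c _ => by positivity
  calc ‖∑ r, ∑ c, u r * w c * M r c‖ ^ 4
      = (‖∑ r, ∑ c, u r * w c * M r c‖ ^ 2) ^ 2 := by ring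
    _ ≤ ((∑ c, ‖w c‖ ^ 2) * (∑ c, ‖∑ r, u r * M r c‖ ^ 2)) ^ 2 := by gcongr
    _ = (∑ c, ‖∑ r, u r * M r c‖ ^ 2) ^ 2 * (∑ c, ‖w c‖ ^ 2) ^ 2 := by ring
    _ ≤ ((∑ r, ∑ r', ‖∑ c, M r c * star (M r' c)‖ ^ 2) * (∑ r, ‖u r‖ ^ 2) ^ 2) *
          (∑ c, ‖w c‖ ^ 2) ^ 2 := by gcongr

end Summit.ValiantsHypothesis.ValiantsHypothesis.Theorems.LiouvilleSarnakDigitalBilinearLiouville.TtStar
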